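import Literature.Algebra.Polynomial.CasasAlvero.PrimePower
import Mathlib.Tactic.IntervalCases
import Mathlib.Tactic.LinearCombination
import HarnessLib

/-!
# Casas-Alvero in degree 7: scenario normal forms (support for `Degree7Char127.lean`)

Elementary, characteristic-free bookkeeping for the scenario method of [CastryckLaterveerOunaies2012, §2] in degree `7`:

* `eval_hasseDeriv_of_septic` — `(H_j g)(θ)` for a monic septic `g` in terms of its coefficients, `j = 2, …, 6`;
* `factor1, …, factor5` — a monic septic `g` with `g(0) = g'(0) = 0` (i.e. `[X^0] g = [X^1] g = 0`) having distinct nonzero roots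
  `r_1, …, r_t` factors as `X^2 (X - r_1)⋯(X - r_t) · h` with `h` monic of degree `5 - t`, written out with coefficients `A_1, …, A_{5-t}`;
* `expand1, …, expand5` — the coefficients of that factored form as polynomials in `r, A`;
* `septic_coeffs_eq` — comparison of coefficients of two septics in sum form.

The scenario normal forms of [CastryckLaterveerOunaies2012, §2], specialised to `d = 7`; used by the kernel-checked case analysis `Degree7Char127.lean` ([cite: CastryckLaterveerOunaies2012, Thm. 4]: `CA_7` holds in characteristic `127`).
No `sorry`, no new axioms.
-/

set_option linter.style.longLine false

noncomputable section

open Polynomial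

namespace Literature.Algebra.Polynomial.CasasAlvero

variable {K : Type*} [Field K]

section Eval

/-- Evaluation of the Hasse derivatives `H_2, …, H_6` of a monic septic in terms of its coefficients (`H_i f = Σ_k C(k,i) a_k X^(k-i)`). [cite: CastryckLaterveerOunaies2012, Sec. 2] -/
theorem eval_hasseDeriv_of_septic {g : K[X]} (hd : g.natDegree = 7) (h7 : g.coeff 7 = 1) (θ : K) :
    (hasseDeriv 2 g).eval θ = 21 * θ ^ 5 + 15 * g.coeff 6 * θ ^ 4 + 10 * g.coeff 5 * θ ^ 3 + 6 * g.coeff 4 * θ ^ 2 +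
        3 * g.coeff 3 * θ + g.coeff 2 ∧
    (hasseDeriv 3 g).eval θ = 35 * θ ^ 4 + 20 * g.coeff 6 * θ ^ 3 + 10 * g.coeff 5 * θ ^ 2 + 4 * g.coeff 4 * θ + g.coeff 3 ∧
    (hasseDeriv 4 g).eval θ = 35 * θ ^ 3 + 15 * g.coeff 6 * θ ^ 2 + 5 * g.coeff 5 * θ + g.coeff 4 ∧
    (hasseDeriv 5 g).eval θ = 21 * θ ^ 2 + 6 * g.coeff 6 * θ + g.coeff 5 ∧
    (hasseDeriv 6 g).eval θ = 7 * θ + g.coeff 6 := by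
  have h8 : ∀ j, 7 < j → g.coeff j = 0 := fun j hj => coeff_eq_zero_of_natDegree_lt (by omega)
  have hlt : ∀ k, 0 < k → (hasseDeriv k g).natDegree < 7 := fun k hk =>
    lt_of_le_of_lt (natDegree_hasseDeriv_le g k) (by omega)
  refine ⟨?_, ?_, ?_, ?_, ?_⟩ <;>
  · rw [eval_eq_sum_range' (hlt _ (by norm_num))]
    simp only [Finset.sum_range_succ, Finset.sum_range_zero, hasseDeriv_coeff, h7, h8 8 (by norm_num),
      h8 9 (by norm_num), h8 10 (by norm_num), h8 11 (by norm_num), h8 12 (by norm_num)]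
    norm_num [Nat.choose]
    try ring

/-- Comparison of coefficients of two septics in the sum form `X^7 + c_6 X^6 + ⋯ + c_2 X^2` (bookkeeping for the scenario normal forms). [cite: CastryckLaterveerOunaies2012, Sec. 2] -/
theorem septic_coeffs_eq {a6 a5 a4 a3 a2 b6 b5 b4 b3 b2 : K}
    (h : X ^ 7 + C a6 * X ^ 6 + C a5 * X ^ 5 + C a4 * X ^ 4 + C a3 * X ^ 3 + C a2 * X ^ 2 =
      X ^ 7 + C b6 * X ^ 6 + C b5 * X ^ 5 + C b4 * X ^ 4 + C b3 * X ^ 3 + C b2 * X ^ 2) :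
    a6 = b6 ∧ a5 = b5 ∧ a4 = b4 ∧ a3 = b3 ∧ a2 = b2 := by
  have hc := fun n => congrArg (fun p : K[X] => p.coeff n) h
  have e6 := hc 6
  have e5 := hc 5
  have e4 := hc 4
  have e3 := hc 3
  have e2 := hc 2
  simp only [coeff_add, coeff_C_mul, coeff_X_pow] at e6 e5 e4 e3 e2
  norm_num at e6 e5 e4 e3 e2
  exact ⟨e6, e5, e4, e3, e2⟩

end Eval

section Factor

/-- Peeling off a linear factor at a root. [folklore] -/
private theorem exists_eq_X_sub_C_mul_of_eval_eq_zero {q : K[X]} {r : K} (h : q.eval r = 0) :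
    ∃ q' : K[X], q = (X - C r) * q' :=
  ⟨q /ₘ (X - C r), (mul_divByMonic_eq_iff_isRoot.mpr h).symm⟩

/-- A root of `M · q` at which `M` does not vanish is a root of `q`. [folklore] -/
private theorem eval_eq_zero_of_mul_eval {M q : K[X]} {r : K} (h : (M * q).eval r = 0) (hM : M.eval r ≠ 0) : q.eval r = 0 := by
  rw [eval_mul] at h
  exact (mul_eq_zero.mp h).resolve_left hM


/-- Type-`1` scenario normal form: a monic septic `g` with `[X^0] g = [X^1] g = 0` and distinct nonzero roots `r_1, …, r_1` is `X^2 (X - r_1)⋯(X - r_1) · h` with `h` monic of degree `4`. [cite: CastryckLaterveerOunaies2012, Sec. 2] -/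
theorem factor1 {g : K[X]} (hg : g.Monic) (hd : g.natDegree = 7) (h0 : g.coeff 0 = 0) (h1 : g.coeff 1 = 0)
    {r1 : K} (n1 : r1 ≠ 0) (g1 : g.eval r1 = 0) :
    ∃ A1 A2 A3 A4 : K, g = X ^ 2 * (X - C r1) * (X ^ 4 + C A1 * X ^ 3 + C A2 * X ^ 2 + C A3 * X + C A4) := by
  obtain ⟨q0, f0⟩ : X ^ 2 ∣ g := X_pow_dvd_iff.mpr (fun d hd2 => by interval_cases d <;> assumption)
  have hM0 : (X ^ 2 : K[X]).Monic := monic_X_pow 2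
  have hMd0 : (X ^ 2 : K[X]).natDegree = 2 := natDegree_X_pow 2
  have e1 : q0.eval r1 = 0 := eval_eq_zero_of_mul_eval (M := X ^ 2) (by rw [← f0]; exact g1)
    (by simp only [eval_pow, eval_X]; exact pow_ne_zero 2 n1)
  obtain ⟨q1, hq1⟩ := exists_eq_X_sub_C_mul_of_eval_eq_zero e1
  have f1 : g = (X ^ 2 * (X - C r1)) * q1 := by rw [f0, hq1]; ring
  have hM1 : (X ^ 2 * (X - C r1) : K[X]).Monic := hM0.mul (monic_X_sub_C r1)
  have hMd1 : (X ^ 2 * (X - C r1) : K[X]).natDegree = 3 := by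
    rw [hM0.natDegree_mul (monic_X_sub_C r1), hMd0, natDegree_X_sub_C]
  have hq : q1.Monic := hM1.of_mul_monic_left (by rw [← f1]; exact hg)
  have hqd : q1.natDegree = 4 := by
    have := hM1.natDegree_mul hq
    rw [← f1, hd, hMd1] at this
    omega
  have hlead : q1.coeff 4 = 1 := by simpa [hqd] using hq.coeff_natDegree
  refine ⟨q1.coeff 3, q1.coeff 2, q1.coeff 1, q1.coeff 0, ?_⟩
  rw [f1]
  congr 1
  conv_lhs => rw [q1.as_sum_range_C_mul_X_pow, hqd]
  simp only [Finset.sum_range_succ, Finset.sum_range_zero, hlead, map_one, one_mul, zero_add, pow_zero, mul_one, pow_one]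
  ring

/-- Type-`2` scenario normal form: a monic septic `g` with `[X^0] g = [X^1] g = 0` and distinct nonzero roots `r_1, …, r_2` is `X^2 (X - r_1)⋯(X - r_2) · h` with `h` monic of degree `3`. [cite: CastryckLaterveerOunaies2012, Sec. 2] -/
theorem factor2 {g : K[X]} (hg : g.Monic) (hd : g.natDegree = 7) (h0 : g.coeff 0 = 0) (h1 : g.coeff 1 = 0)
    {r1 r2 : K} (n1 : r1 ≠ 0) (n2 : r2 ≠ 0) (d21 : r2 ≠ r1) (g1 : g.eval r1 = 0) (g2 : g.eval r2 = 0) :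
    ∃ A1 A2 A3 : K, g = X ^ 2 * (X - C r1) * (X - C r2) * (X ^ 3 + C A1 * X ^ 2 + C A2 * X + C A3) := by
  obtain ⟨q0, f0⟩ : X ^ 2 ∣ g := X_pow_dvd_iff.mpr (fun d hd2 => by interval_cases d <;> assumption)
  have hM0 : (X ^ 2 : K[X]).Monic := monic_X_pow 2
  have hMd0 : (X ^ 2 : K[X]).natDegree = 2 := natDegree_X_pow 2
  have e1 : q0.eval r1 = 0 := eval_eq_zero_of_mul_eval (M := X ^ 2) (by rw [← f0]; exact g1)
    (by simp only [eval_pow, eval_X]; exact pow_ne_zero 2 n1)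
  obtain ⟨q1, hq1⟩ := exists_eq_X_sub_C_mul_of_eval_eq_zero e1
  have f1 : g = (X ^ 2 * (X - C r1)) * q1 := by rw [f0, hq1]; ring
  have hM1 : (X ^ 2 * (X - C r1) : K[X]).Monic := hM0.mul (monic_X_sub_C r1)
  have hMd1 : (X ^ 2 * (X - C r1) : K[X]).natDegree = 3 := by
    rw [hM0.natDegree_mul (monic_X_sub_C r1), hMd0, natDegree_X_sub_C]
  have e2 : q1.eval r2 = 0 := eval_eq_zero_of_mul_eval (M := X ^ 2 * (X - C r1)) (by rw [← f1]; exact g2)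
    (by simp only [eval_mul, eval_pow, eval_X, eval_sub, eval_C]; exact mul_ne_zero (pow_ne_zero 2 n2) (sub_ne_zero.mpr d21))
  obtain ⟨q2, hq2⟩ := exists_eq_X_sub_C_mul_of_eval_eq_zero e2
  have f2 : g = (X ^ 2 * (X - C r1) * (X - C r2)) * q2 := by rw [f1, hq2]; ring
  have hM2 : (X ^ 2 * (X - C r1) * (X - C r2) : K[X]).Monic := hM1.mul (monic_X_sub_C r2)
  have hMd2 : (X ^ 2 * (X - C r1) * (X - C r2) : K[X]).natDegree = 4 := by
    rw [hM1.natDegree_mul (monic_X_sub_C r2), hMd1, natDegree_X_sub_C]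
  have hq : q2.Monic := hM2.of_mul_monic_left (by rw [← f2]; exact hg)
  have hqd : q2.natDegree = 3 := by
    have := hM2.natDegree_mul hq
    rw [← f2, hd, hMd2] at this
    omega
  have hlead : q2.coeff 3 = 1 := by simpa [hqd] using hq.coeff_natDegree
  refine ⟨q2.coeff 2, q2.coeff 1, q2.coeff 0, ?_⟩
  rw [f2]
  congr 1
  conv_lhs => rw [q2.as_sum_range_C_mul_X_pow, hqd]
  simp only [Finset.sum_range_succ, Finset.sum_range_zero, hlead, map_one, one_mul, zero_add, pow_zero, mul_one, pow_one]
  ring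

/-- Type-`3` scenario normal form: a monic septic `g` with `[X^0] g = [X^1] g = 0` and distinct nonzero roots `r_1, …, r_3` is `X^2 (X - r_1)⋯(X - r_3) · h` with `h` monic of degree `2`. [cite: CastryckLaterveerOunaies2012, Sec. 2] -/
theorem factor3 {g : K[X]} (hg : g.Monic) (hd : g.natDegree = 7) (h0 : g.coeff 0 = 0) (h1 : g.coeff 1 = 0)
    {r1 r2 r3 : K} (n1 : r1 ≠ 0) (n2 : r2 ≠ 0) (n3 : r3 ≠ 0) (d21 : r2 ≠ r1) (d31 : r3 ≠ r1) (d32 : r3 ≠ r2) (g1 : g.eval r1 = 0) (g2 : g.eval r2 = 0) (g3 : g.eval r3 = 0) :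
    ∃ A1 A2 : K, g = X ^ 2 * (X - C r1) * (X - C r2) * (X - C r3) * (X ^ 2 + C A1 * X + C A2) := by
  obtain ⟨q0, f0⟩ : X ^ 2 ∣ g := X_pow_dvd_iff.mpr (fun d hd2 => by interval_cases d <;> assumption)
  have hM0 : (X ^ 2 : K[X]).Monic := monic_X_pow 2
  have hMd0 : (X ^ 2 : K[X]).natDegree = 2 := natDegree_X_pow 2
  have e1 : q0.eval r1 = 0 := eval_eq_zero_of_mul_eval (M := X ^ 2) (by rw [← f0]; exact g1)
    (by simp only [eval_pow, eval_X]; exact pow_ne_zero 2 n1)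
  obtain ⟨q1, hq1⟩ := exists_eq_X_sub_C_mul_of_eval_eq_zero e1
  have f1 : g = (X ^ 2 * (X - C r1)) * q1 := by rw [f0, hq1]; ring
  have hM1 : (X ^ 2 * (X - C r1) : K[X]).Monic := hM0.mul (monic_X_sub_C r1)
  have hMd1 : (X ^ 2 * (X - C r1) : K[X]).natDegree = 3 := by
    rw [hM0.natDegree_mul (monic_X_sub_C r1), hMd0, natDegree_X_sub_C]
  have e2 : q1.eval r2 = 0 := eval_eq_zero_of_mul_eval (M := X ^ 2 * (X - C r1)) (by rw [← f1]; exact g2)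
    (by simp only [eval_mul, eval_pow, eval_X, eval_sub, eval_C]; exact mul_ne_zero (pow_ne_zero 2 n2) (sub_ne_zero.mpr d21))
  obtain ⟨q2, hq2⟩ := exists_eq_X_sub_C_mul_of_eval_eq_zero e2
  have f2 : g = (X ^ 2 * (X - C r1) * (X - C r2)) * q2 := by rw [f1, hq2]; ring
  have hM2 : (X ^ 2 * (X - C r1) * (X - C r2) : K[X]).Monic := hM1.mul (monic_X_sub_C r2)
  have hMd2 : (X ^ 2 * (X - C r1) * (X - C r2) : K[X]).natDegree = 4 := by
    rw [hM1.natDegree_mul (monic_X_sub_C r2), hMd1, natDegree_X_sub_C]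
  have e3 : q2.eval r3 = 0 := eval_eq_zero_of_mul_eval (M := X ^ 2 * (X - C r1) * (X - C r2)) (by rw [← f2]; exact g3)
    (by simp only [eval_mul, eval_pow, eval_X, eval_sub, eval_C]; exact mul_ne_zero (mul_ne_zero (pow_ne_zero 2 n3) (sub_ne_zero.mpr d31)) (sub_ne_zero.mpr d32))
  obtain ⟨q3, hq3⟩ := exists_eq_X_sub_C_mul_of_eval_eq_zero e3
  have f3 : g = (X ^ 2 * (X - C r1) * (X - C r2) * (X - C r3)) * q3 := by rw [f2, hq3]; ring
  have hM3 : (X ^ 2 * (X - C r1) * (X - C r2) * (X - C r3) : K[X]).Monic := hM2.mul (monic_X_sub_C r3)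
  have hMd3 : (X ^ 2 * (X - C r1) * (X - C r2) * (X - C r3) : K[X]).natDegree = 5 := by
    rw [hM2.natDegree_mul (monic_X_sub_C r3), hMd2, natDegree_X_sub_C]
  have hq : q3.Monic := hM3.of_mul_monic_left (by rw [← f3]; exact hg)
  have hqd : q3.natDegree = 2 := by
    have := hM3.natDegree_mul hq
    rw [← f3, hd, hMd3] at this
    omega
  have hlead : q3.coeff 2 = 1 := by simpa [hqd] using hq.coeff_natDegree
  refine ⟨q3.coeff 1, q3.coeff 0, ?_⟩
  rw [f3]
  congr 1
  conv_lhs => rw [q3.as_sum_range_C_mul_X_pow, hqd]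
  simp only [Finset.sum_range_succ, Finset.sum_range_zero, hlead, map_one, one_mul, zero_add, pow_zero, mul_one, pow_one]
  ring

/-- Type-`4` scenario normal form: a monic septic `g` with `[X^0] g = [X^1] g = 0` and distinct nonzero roots `r_1, …, r_4` is `X^2 (X - r_1)⋯(X - r_4) · h` with `h` monic of degree `1`. [cite: CastryckLaterveerOunaies2012, Sec. 2] -/
theorem factor4 {g : K[X]} (hg : g.Monic) (hd : g.natDegree = 7) (h0 : g.coeff 0 = 0) (h1 : g.coeff 1 = 0)
    {r1 r2 r3 r4 : K} (n1 : r1 ≠ 0) (n2 : r2 ≠ 0) (n3 : r3 ≠ 0) (n4 : r4 ≠ 0) (d21 : r2 ≠ r1) (d31 : r3 ≠ r1) (d32 : r3 ≠ r2) (d41 : r4 ≠ r1) (d42 : r4 ≠ r2) (d43 : r4 ≠ r3) (g1 : g.eval r1 = 0) (g2 : g.eval r2 = 0) (g3 : g.eval r3 = 0) (g4 : g.eval r4 = 0) :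
    ∃ A1 : K, g = X ^ 2 * (X - C r1) * (X - C r2) * (X - C r3) * (X - C r4) * (X + C A1) := by
  obtain ⟨q0, f0⟩ : X ^ 2 ∣ g := X_pow_dvd_iff.mpr (fun d hd2 => by interval_cases d <;> assumption)
  have hM0 : (X ^ 2 : K[X]).Monic := monic_X_pow 2
  have hMd0 : (X ^ 2 : K[X]).natDegree = 2 := natDegree_X_pow 2
  have e1 : q0.eval r1 = 0 := eval_eq_zero_of_mul_eval (M := X ^ 2) (by rw [← f0]; exact g1)
    (by simp only [eval_pow, eval_X]; exact pow_ne_zero 2 n1)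
  obtain ⟨q1, hq1⟩ := exists_eq_X_sub_C_mul_of_eval_eq_zero e1
  have f1 : g = (X ^ 2 * (X - C r1)) * q1 := by rw [f0, hq1]; ring
  have hM1 : (X ^ 2 * (X - C r1) : K[X]).Monic := hM0.mul (monic_X_sub_C r1)
  have hMd1 : (X ^ 2 * (X - C r1) : K[X]).natDegree = 3 := by
    rw [hM0.natDegree_mul (monic_X_sub_C r1), hMd0, natDegree_X_sub_C]
  have e2 : q1.eval r2 = 0 := eval_eq_zero_of_mul_eval (M := X ^ 2 * (X - C r1)) (by rw [← f1]; exact g2)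
    (by simp only [eval_mul, eval_pow, eval_X, eval_sub, eval_C]; exact mul_ne_zero (pow_ne_zero 2 n2) (sub_ne_zero.mpr d21))
  obtain ⟨q2, hq2⟩ := exists_eq_X_sub_C_mul_of_eval_eq_zero e2
  have f2 : g = (X ^ 2 * (X - C r1) * (X - C r2)) * q2 := by rw [f1, hq2]; ring
  have hM2 : (X ^ 2 * (X - C r1) * (X - C r2) : K[X]).Monic := hM1.mul (monic_X_sub_C r2)
  have hMd2 : (X ^ 2 * (X - C r1) * (X - C r2) : K[X]).natDegree = 4 := by
    rw [hM1.natDegree_mul (monic_X_sub_C r2), hMd1, natDegree_X_sub_C]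
  have e3 : q2.eval r3 = 0 := eval_eq_zero_of_mul_eval (M := X ^ 2 * (X - C r1) * (X - C r2)) (by rw [← f2]; exact g3)
    (by simp only [eval_mul, eval_pow, eval_X, eval_sub, eval_C]; exact mul_ne_zero (mul_ne_zero (pow_ne_zero 2 n3) (sub_ne_zero.mpr d31)) (sub_ne_zero.mpr d32))
  obtain ⟨q3, hq3⟩ := exists_eq_X_sub_C_mul_of_eval_eq_zero e3
  have f3 : g = (X ^ 2 * (X - C r1) * (X - C r2) * (X - C r3)) * q3 := by rw [f2, hq3]; ring
  have hM3 : (X ^ 2 * (X - C r1) * (X - C r2) * (X - C r3) : K[X]).Monic := hM2.mul (monic_X_sub_C r3)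
  have hMd3 : (X ^ 2 * (X - C r1) * (X - C r2) * (X - C r3) : K[X]).natDegree = 5 := by
    rw [hM2.natDegree_mul (monic_X_sub_C r3), hMd2, natDegree_X_sub_C]
  have e4 : q3.eval r4 = 0 := eval_eq_zero_of_mul_eval (M := X ^ 2 * (X - C r1) * (X - C r2) * (X - C r3)) (by rw [← f3]; exact g4)
    (by simp only [eval_mul, eval_pow, eval_X, eval_sub, eval_C]; exact mul_ne_zero (mul_ne_zero (mul_ne_zero (pow_ne_zero 2 n4) (sub_ne_zero.mpr d41)) (sub_ne_zero.mpr d42)) (sub_ne_zero.mpr d43))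
  obtain ⟨q4, hq4⟩ := exists_eq_X_sub_C_mul_of_eval_eq_zero e4
  have f4 : g = (X ^ 2 * (X - C r1) * (X - C r2) * (X - C r3) * (X - C r4)) * q4 := by rw [f3, hq4]; ring
  have hM4 : (X ^ 2 * (X - C r1) * (X - C r2) * (X - C r3) * (X - C r4) : K[X]).Monic := hM3.mul (monic_X_sub_C r4)
  have hMd4 : (X ^ 2 * (X - C r1) * (X - C r2) * (X - C r3) * (X - C r4) : K[X]).natDegree = 6 := by
    rw [hM3.natDegree_mul (monic_X_sub_C r4), hMd3, natDegree_X_sub_C]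
  have hq : q4.Monic := hM4.of_mul_monic_left (by rw [← f4]; exact hg)
  have hqd : q4.natDegree = 1 := by
    have := hM4.natDegree_mul hq
    rw [← f4, hd, hMd4] at this
    omega
  have hlead : q4.coeff 1 = 1 := by simpa [hqd] using hq.coeff_natDegree
  refine ⟨q4.coeff 0, ?_⟩
  rw [f4]
  congr 1
  conv_lhs => rw [q4.as_sum_range_C_mul_X_pow, hqd]
  simp only [Finset.sum_range_succ, Finset.sum_range_zero, hlead, map_one, one_mul, zero_add, pow_zero, mul_one, pow_one]
  ring

/-- Type-`5` scenario normal form: a monic septic `g` with `[X^0] g = [X^1] g = 0` and distinct nonzero roots `r_1, …, r_5` is `X^2 (X - r_1)⋯(X - r_5) · h` with `h` monic of degree `0`. [cite: CastryckLaterveerOunaies2012, Sec. 2] -/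
theorem factor5 {g : K[X]} (hg : g.Monic) (hd : g.natDegree = 7) (h0 : g.coeff 0 = 0) (h1 : g.coeff 1 = 0)
    {r1 r2 r3 r4 r5 : K} (n1 : r1 ≠ 0) (n2 : r2 ≠ 0) (n3 : r3 ≠ 0) (n4 : r4 ≠ 0) (n5 : r5 ≠ 0) (d21 : r2 ≠ r1) (d31 : r3 ≠ r1) (d32 : r3 ≠ r2) (d41 : r4 ≠ r1) (d42 : r4 ≠ r2) (d43 : r4 ≠ r3) (d51 : r5 ≠ r1) (d52 : r5 ≠ r2) (d53 : r5 ≠ r3) (d54 : r5 ≠ r4) (g1 : g.eval r1 = 0) (g2 : g.eval r2 = 0) (g3 : g.eval r3 = 0) (g4 : g.eval r4 = 0) (g5 : g.eval r5 = 0) :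
    g = X ^ 2 * (X - C r1) * (X - C r2) * (X - C r3) * (X - C r4) * (X - C r5) := by
  obtain ⟨q0, f0⟩ : X ^ 2 ∣ g := X_pow_dvd_iff.mpr (fun d hd2 => by interval_cases d <;> assumption)
  have hM0 : (X ^ 2 : K[X]).Monic := monic_X_pow 2
  have hMd0 : (X ^ 2 : K[X]).natDegree = 2 := natDegree_X_pow 2
  have e1 : q0.eval r1 = 0 := eval_eq_zero_of_mul_eval (M := X ^ 2) (by rw [← f0]; exact g1)
    (by simp only [eval_pow, eval_X]; exact pow_ne_zero 2 n1)
  obtain ⟨q1, hq1⟩ := exists_eq_X_sub_C_mul_of_eval_eq_zero e1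
  have f1 : g = (X ^ 2 * (X - C r1)) * q1 := by rw [f0, hq1]; ring
  have hM1 : (X ^ 2 * (X - C r1) : K[X]).Monic := hM0.mul (monic_X_sub_C r1)
  have hMd1 : (X ^ 2 * (X - C r1) : K[X]).natDegree = 3 := by
    rw [hM0.natDegree_mul (monic_X_sub_C r1), hMd0, natDegree_X_sub_C]
  have e2 : q1.eval r2 = 0 := eval_eq_zero_of_mul_eval (M := X ^ 2 * (X - C r1)) (by rw [← f1]; exact g2)
    (by simp only [eval_mul, eval_pow, eval_X, eval_sub, eval_C]; exact mul_ne_zero (pow_ne_zero 2 n2) (sub_ne_zero.mpr d21))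
  obtain ⟨q2, hq2⟩ := exists_eq_X_sub_C_mul_of_eval_eq_zero e2
  have f2 : g = (X ^ 2 * (X - C r1) * (X - C r2)) * q2 := by rw [f1, hq2]; ring
  have hM2 : (X ^ 2 * (X - C r1) * (X - C r2) : K[X]).Monic := hM1.mul (monic_X_sub_C r2)
  have hMd2 : (X ^ 2 * (X - C r1) * (X - C r2) : K[X]).natDegree = 4 := by
    rw [hM1.natDegree_mul (monic_X_sub_C r2), hMd1, natDegree_X_sub_C]
  have e3 : q2.eval r3 = 0 := eval_eq_zero_of_mul_eval (M := X ^ 2 * (X - C r1) * (X - C r2)) (by rw [← f2]; exact g3)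
    (by simp only [eval_mul, eval_pow, eval_X, eval_sub, eval_C]; exact mul_ne_zero (mul_ne_zero (pow_ne_zero 2 n3) (sub_ne_zero.mpr d31)) (sub_ne_zero.mpr d32))
  obtain ⟨q3, hq3⟩ := exists_eq_X_sub_C_mul_of_eval_eq_zero e3
  have f3 : g = (X ^ 2 * (X - C r1) * (X - C r2) * (X - C r3)) * q3 := by rw [f2, hq3]; ring
  have hM3 : (X ^ 2 * (X - C r1) * (X - C r2) * (X - C r3) : K[X]).Monic := hM2.mul (monic_X_sub_C r3)
  have hMd3 : (X ^ 2 * (X - C r1) * (X - C r2) * (X - C r3) : K[X]).natDegree = 5 := by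
    rw [hM2.natDegree_mul (monic_X_sub_C r3), hMd2, natDegree_X_sub_C]
  have e4 : q3.eval r4 = 0 := eval_eq_zero_of_mul_eval (M := X ^ 2 * (X - C r1) * (X - C r2) * (X - C r3)) (by rw [← f3]; exact g4)
    (by simp only [eval_mul, eval_pow, eval_X, eval_sub, eval_C]; exact mul_ne_zero (mul_ne_zero (mul_ne_zero (pow_ne_zero 2 n4) (sub_ne_zero.mpr d41)) (sub_ne_zero.mpr d42)) (sub_ne_zero.mpr d43))
  obtain ⟨q4, hq4⟩ := exists_eq_X_sub_C_mul_of_eval_eq_zero e4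
  have f4 : g = (X ^ 2 * (X - C r1) * (X - C r2) * (X - C r3) * (X - C r4)) * q4 := by rw [f3, hq4]; ring
  have hM4 : (X ^ 2 * (X - C r1) * (X - C r2) * (X - C r3) * (X - C r4) : K[X]).Monic := hM3.mul (monic_X_sub_C r4)
  have hMd4 : (X ^ 2 * (X - C r1) * (X - C r2) * (X - C r3) * (X - C r4) : K[X]).natDegree = 6 := by
    rw [hM3.natDegree_mul (monic_X_sub_C r4), hMd3, natDegree_X_sub_C]
  have e5 : q4.eval r5 = 0 := eval_eq_zero_of_mul_eval (M := X ^ 2 * (X - C r1) * (X - C r2) * (X - C r3) * (X - C r4)) (by rw [← f4]; exact g5)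
    (by simp only [eval_mul, eval_pow, eval_X, eval_sub, eval_C]; exact mul_ne_zero (mul_ne_zero (mul_ne_zero (mul_ne_zero (pow_ne_zero 2 n5) (sub_ne_zero.mpr d51)) (sub_ne_zero.mpr d52)) (sub_ne_zero.mpr d53)) (sub_ne_zero.mpr d54))
  obtain ⟨q5, hq5⟩ := exists_eq_X_sub_C_mul_of_eval_eq_zero e5
  have f5 : g = (X ^ 2 * (X - C r1) * (X - C r2) * (X - C r3) * (X - C r4) * (X - C r5)) * q5 := by rw [f4, hq5]; ring
  have hM5 : (X ^ 2 * (X - C r1) * (X - C r2) * (X - C r3) * (X - C r4) * (X - C r5) : K[X]).Monic := hM4.mul (monic_X_sub_C r5)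
  have hMd5 : (X ^ 2 * (X - C r1) * (X - C r2) * (X - C r3) * (X - C r4) * (X - C r5) : K[X]).natDegree = 7 := by
    rw [hM4.natDegree_mul (monic_X_sub_C r5), hMd4, natDegree_X_sub_C]
  have hq : q5.Monic := hM5.of_mul_monic_left (by rw [← f5]; exact hg)
  have hqd : q5.natDegree = 0 := by
    have := hM5.natDegree_mul hq
    rw [← f5, hd, hMd5] at this
    omega
  rw [f5, eq_one_of_monic_natDegree_zero hq hqd, mul_one]

end Factor

section Expand

/-- Expansion of the type-`1` scenario normal form `X^2 (X - r_1)⋯(X - r_1) · h` of a septic: its coefficients as polynomials in `r, A`. [cite: CastryckLaterveerOunaies2012, Sec. 2] -/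
theorem expand1 (r1 A1 A2 A3 A4 : K) :
    X ^ 2 * (X - C r1) * (X ^ 4 + C A1 * X ^ 3 + C A2 * X ^ 2 + C A3 * X + C A4) =
      X ^ 7 + C (A1 + (-1) * r1) * X ^ 6 + C ((-1) * r1 * A1 + A2) * X ^ 5 + C ((-1) * r1 * A2 + A3) * X ^ 4 +
        C ((-1) * r1 * A3 + A4) * X ^ 3 + C ((-1) * r1 * A4) * X ^ 2 := by
  simp only [map_add, map_mul, map_neg, map_one]
  ring

/-- Expansion of the type-`2` scenario normal form `X^2 (X - r_1)⋯(X - r_2) · h` of a septic: its coefficients as polynomials in `r, A`. [cite: CastryckLaterveerOunaies2012, Sec. 2] -/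
theorem expand2 (r1 r2 A1 A2 A3 : K) :
    X ^ 2 * (X - C r1) * (X - C r2) * (X ^ 3 + C A1 * X ^ 2 + C A2 * X + C A3) =
      X ^ 7 + C (A1 + (-1) * r2 + (-1) * r1) * X ^ 6 + C ((-1) * r2 * A1 + (-1) * r1 * A1 + r1 * r2 + A2) * X ^ 5 +
        C (r1 * r2 * A1 + (-1) * r2 * A2 + (-1) * r1 * A2 + A3) * X ^ 4 + C (r1 * r2 * A2 + (-1) * r2 * A3 +
        (-1) * r1 * A3) * X ^ 3 + C (r1 * r2 * A3) * X ^ 2 := by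
  simp only [map_add, map_mul, map_neg, map_one]
  ring

/-- Expansion of the type-`3` scenario normal form `X^2 (X - r_1)⋯(X - r_3) · h` of a septic: its coefficients as polynomials in `r, A`. [cite: CastryckLaterveerOunaies2012, Sec. 2] -/
theorem expand3 (r1 r2 r3 A1 A2 : K) :
    X ^ 2 * (X - C r1) * (X - C r2) * (X - C r3) * (X ^ 2 + C A1 * X + C A2) =
      X ^ 7 + C (A1 + (-1) * r3 + (-1) * r2 + (-1) * r1) * X ^ 6 + C ((-1) * r3 * A1 + (-1) * r2 * A1 + r2 * r3 +
        (-1) * r1 * A1 + r1 * r3 + r1 * r2 + A2) * X ^ 5 + C (r2 * r3 * A1 + r1 * r3 * A1 + r1 * r2 * A1 + (-1) * r1 * r2 * r3 +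
        (-1) * r3 * A2 + (-1) * r2 * A2 + (-1) * r1 * A2) * X ^ 4 + C ((-1) * r1 * r2 * r3 * A1 + r2 * r3 * A2 + r1 * r3 * A2 +
        r1 * r2 * A2) * X ^ 3 + C ((-1) * r1 * r2 * r3 * A2) * X ^ 2 := by
  simp only [map_add, map_mul, map_neg, map_one]
  ring

/-- Expansion of the type-`4` scenario normal form `X^2 (X - r_1)⋯(X - r_4) · h` of a septic: its coefficients as polynomials in `r, A`. [cite: CastryckLaterveerOunaies2012, Sec. 2] -/
theorem expand4 (r1 r2 r3 r4 A1 : K) :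
    X ^ 2 * (X - C r1) * (X - C r2) * (X - C r3) * (X - C r4) * (X + C A1) =
      X ^ 7 + C (A1 + (-1) * r4 + (-1) * r3 + (-1) * r2 + (-1) * r1) * X ^ 6 + C ((-1) * r4 * A1 + (-1) * r3 * A1 + r3 * r4 +
        (-1) * r2 * A1 + r2 * r4 + r2 * r3 + (-1) * r1 * A1 + r1 * r4 + r1 * r3 + r1 * r2) * X ^ 5 + C (r3 * r4 * A1 +
        r2 * r4 * A1 + r2 * r3 * A1 + (-1) * r2 * r3 * r4 + r1 * r4 * A1 + r1 * r3 * A1 + (-1) * r1 * r3 * r4 + r1 * r2 * A1 +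
        (-1) * r1 * r2 * r4 + (-1) * r1 * r2 * r3) * X ^ 4 + C ((-1) * r2 * r3 * r4 * A1 + (-1) * r1 * r3 * r4 * A1 +
        (-1) * r1 * r2 * r4 * A1 + (-1) * r1 * r2 * r3 * A1 + r1 * r2 * r3 * r4) * X ^ 3 + C (r1 * r2 * r3 * r4 * A1) * X ^ 2 := by
  simp only [map_add, map_mul, map_neg, map_one]
  ring

/-- Expansion of the type-`5` scenario normal form `X^2 (X - r_1)⋯(X - r_5) · h` of a septic: its coefficients as polynomials in `r, A`. [cite: CastryckLaterveerOunaies2012, Sec. 2] -/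
theorem expand5 (r1 r2 r3 r4 r5 : K) :
    X ^ 2 * (X - C r1) * (X - C r2) * (X - C r3) * (X - C r4) * (X - C r5) =
      X ^ 7 + C ((-1) * r5 + (-1) * r4 + (-1) * r3 + (-1) * r2 + (-1) * r1) * X ^ 6 + C (r4 * r5 + r3 * r5 + r3 * r4 + r2 * r5 +
        r2 * r4 + r2 * r3 + r1 * r5 + r1 * r4 + r1 * r3 + r1 * r2) * X ^ 5 + C ((-1) * r3 * r4 * r5 + (-1) * r2 * r4 * r5 +
        (-1) * r2 * r3 * r5 + (-1) * r2 * r3 * r4 + (-1) * r1 * r4 * r5 + (-1) * r1 * r3 * r5 + (-1) * r1 * r3 * r4 +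
        (-1) * r1 * r2 * r5 + (-1) * r1 * r2 * r4 + (-1) * r1 * r2 * r3) * X ^ 4 + C (r2 * r3 * r4 * r5 + r1 * r3 * r4 * r5 +
        r1 * r2 * r4 * r5 + r1 * r2 * r3 * r5 + r1 * r2 * r3 * r4) * X ^ 3 + C ((-1) * r1 * r2 * r3 * r4 * r5) * X ^ 2 := by
  simp only [map_add, map_mul, map_neg, map_one]
  ring

end Expand

end Literature.Algebra.Polynomial.CasasAlvero
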